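import Literature.Algebra.Polynomial.CasasAlvero.Char193Digits
import Literature.Algebra.Polynomial.CasasAlvero.Pentanomial
import Literature.Algebra.Polynomial.CasasAlvero.Degree6CandidatesPrime
import Literature.Algebra.Polynomial.CasasAlvero.Degree5CharPLarge
import Literature.Algebra.Polynomial.CasasAlvero.Degree6
import Literature.Algebra.Polynomial.CasasAlvero.DigitReduction
import HarnessLib

/-!
# Casas-Alvero degrees in characteristic 193: the complete classification — the second digit set that is not an initial segment

Over EVERY field `K` of characteristic `193`: `CA_d(K) ⟺ d = 0 ∨ d = a·193^k` with `a ∈ {1, 2, 3, 4, 6}` — the same digit set as in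
characteristic `131` (`CharOneHundredThirtyOneComplete.lean`, the first prime whose Casas-Alvero digits are not an initial segment `{1, …, N(p)}`);
`193` is the second: the digit `5` is BAD — `193` is one of the nine bad primes `2, 3, 7, 11, 131, 193, 599, 3541, 8009` of degree `5`
([GrafVonBothmerEtAl2007, Prop. 7], [CastryckLaterveerOunaies2012, Thm. 4]; in the tree `Degree5CharPLarge.lean`,
`not_holdsInDegree_five_of_charP_large`) — while the digit `6` is GOOD: `193` is not among the `54` candidate bad primes of degree `6`
(`Degree6CandidatesPrime.lean`, `holdsInDegree_six_of_not_mem`; [CastryckLaterveerOunaies2012, Thm. 4]).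
Other ingredients: the digit reduction `CA_d ⇒ d = a·p^k ∧ CA_a` (`DigitReduction.lean`, any field); the positive digits `1, 2, 3, 4`
([GrafVonBothmerEtAl2007, Props. 2, 6]); and a refutation of every digit `7 ≤ a ≤ 192` over every field of characteristic `193`:
`30, 34, 39, 49, 60, 65, 67, 72, 77, 79, 80, 81, 84, 85, 91, 96, 98, 99, 101, 103, 109, 112, 119, 120, 121, 123, 124, 125, 131, 132, 137, 138, 147, 148, 149, 150, 154, 156, 157, 159, 171, 178, 181, 182, 184, 185, 187, 188, 189, 192` by the binomial criterion
(`m = 11, 3, 18, 6, 29, 10, 22, 17, 11, 18, 8, 12, 35, 14, 7, 36, 43, 10, 5, 10, 54, 44, 28, 8, 14, 12, 44, 55, 18, 11, 10, 42, 22, 15, 6, 54, 33, 60, 11, 3, 18, 73, 35, 47, 72, 84, 91, 41, 33, 2`), the digit `7` (so `193` is a bad prime for degree `7`, consistent with the bad-prime computation of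
[CastryckLaterveerOunaies2012, Thm. 4]) and the 135 remaining digits by the sparse `𝔽_193`-examples of `Char193Digits.lean`.
-/

noncomputable section

open Polynomial

set_option maxRecDepth 8192

namespace Literature.Algebra.Polynomial.CasasAlvero

section CharOneHundredNinetyThree

variable (K : Type*) [Field K] [CharP K 193]

/-- `CA_{6·193^k}` over every field of characteristic `193` (`CA_6` itself — the case `k = 0` — holds because `193` is not among the
`54` candidate bad primes of degree `6` of `Degree6CandidatesPrime.lean`, `holdsInDegree_six_of_not_mem`, i.e. `193` is a GOOD prime for degree `6`
[cite: CastryckLaterveerOunaies2012, Thm. 4]) — although the smaller digit `5` is bad. [cite: GrafVonBothmerEtAl2007, Prop. 6] -/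
theorem holdsInDegree_six_mul_pow_of_char_193' (k : ℕ) : HoldsInDegree K (6 * 193 ^ k) := by
  haveI : Fact (Nat.Prime 193) := ⟨by norm_num⟩
  exact holdsInDegree_mul_prime_pow_field K 193 (holdsInDegree_six_of_not_mem (K := AlgebraicClosure K) 193 (by decide)) k

set_option maxHeartbeats 1000000 in
/-- every digit `7 ≤ a < 193` fails: `¬ CA_a` over every field of characteristic `193` — the bad-prime computations of
[cite: CastryckLaterveerOunaies2012, Thm. 4] (degrees `≤ 7`) extended to every digit `7 ≤ a < 193` by explicit `𝔽_193`-rational examples and the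
binomial criterion. [cite: GrafVonBothmerEtAl2007, Prop. 6] -/
theorem not_holdsInDegree_digit_of_char_oneHundredNinetyThree {a : ℕ} (h7 : 7 ≤ a) (hap : a < 193) : ¬ HoldsInDegree K a := by
  haveI : Fact (Nat.Prime 193) := ⟨by norm_num⟩
  interval_cases a
  · exact not_holdsInDegree_seven_of_char_193 K
  · exact not_holdsInDegree_eight_of_char_193 K
  · exact not_holdsInDegree_nine_of_char_193 K
  · exact not_holdsInDegree_ten_of_char_193 K
  · exact not_holdsInDegree_eleven_of_char_193 K
  · exact not_holdsInDegree_twelve_of_char_193 K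
  · exact not_holdsInDegree_thirteen_of_char_193 K
  · exact not_holdsInDegree_fourteen_of_char_193 K
  · exact not_holdsInDegree_fifteen_of_char_193 K
  · exact not_holdsInDegree_sixteen_of_char_193 K
  · exact not_holdsInDegree_seventeen_of_char_193 K
  · exact not_holdsInDegree_eighteen_of_char_193 K
  · exact not_holdsInDegree_nineteen_of_char_193 K
  · exact not_holdsInDegree_twenty_of_char_193 K
  · exact not_holdsInDegree_twentyOne_of_char_193 K
  · exact not_holdsInDegree_twentyTwo_of_char_193 K
  · exact not_holdsInDegree_twentyThree_of_char_193 K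
  · exact not_holdsInDegree_twentyFour_of_char_193 K
  · exact not_holdsInDegree_twentyFive_of_char_193 K
  · exact not_holdsInDegree_twentySix_of_char_193 K
  · exact not_holdsInDegree_twentySeven_of_char_193 K
  · exact not_holdsInDegree_twentyEight_of_char_193 K
  · exact not_holdsInDegree_twentyNine_of_char_193 K
  · exact not_holdsInDegree_of_choose_modEq_one K 193 (d := 30) (m := 11) (by norm_num) (by norm_num) (by decide)
  · exact not_holdsInDegree_thirtyOne_of_char_193 K
  · exact not_holdsInDegree_thirtyTwo_of_char_193 K
  · exact not_holdsInDegree_thirtyThree_of_char_193 K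
  · exact not_holdsInDegree_of_choose_modEq_one K 193 (d := 34) (m := 3) (by norm_num) (by norm_num) (by decide)
  · exact not_holdsInDegree_thirtyFive_of_char_193 K
  · exact not_holdsInDegree_thirtySix_of_char_193 K
  · exact not_holdsInDegree_thirtySeven_of_char_193 K
  · exact not_holdsInDegree_thirtyEight_of_char_193 K
  · exact not_holdsInDegree_of_choose_modEq_one K 193 (d := 39) (m := 18) (by norm_num) (by norm_num) (by decide)
  · exact not_holdsInDegree_forty_of_char_193 K
  · exact not_holdsInDegree_fortyOne_of_char_193 K
  · exact not_holdsInDegree_fortyTwo_of_char_193 K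
  · exact not_holdsInDegree_fortyThree_of_char_193 K
  · exact not_holdsInDegree_fortyFour_of_char_193 K
  · exact not_holdsInDegree_fortyFive_of_char_193 K
  · exact not_holdsInDegree_fortySix_of_char_193 K
  · exact not_holdsInDegree_fortySeven_of_char_193 K
  · exact not_holdsInDegree_fortyEight_of_char_193 K
  · exact not_holdsInDegree_of_choose_modEq_one K 193 (d := 49) (m := 6) (by norm_num) (by norm_num) (by decide)
  · exact not_holdsInDegree_fifty_of_char_193 K
  · exact not_holdsInDegree_fiftyOne_of_char_193 K
  · exact not_holdsInDegree_fiftyTwo_of_char_193 K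
  · exact not_holdsInDegree_fiftyThree_of_char_193 K
  · exact not_holdsInDegree_fiftyFour_of_char_193 K
  · exact not_holdsInDegree_fiftyFive_of_char_193 K
  · exact not_holdsInDegree_fiftySix_of_char_193 K
  · exact not_holdsInDegree_fiftySeven_of_char_193 K
  · exact not_holdsInDegree_fiftyEight_of_char_193 K
  · exact not_holdsInDegree_fiftyNine_of_char_193 K
  · exact not_holdsInDegree_of_choose_modEq_one K 193 (d := 60) (m := 29) (by norm_num) (by norm_num) (by decide)
  · exact not_holdsInDegree_sixtyOne_of_char_193 K
  · exact not_holdsInDegree_sixtyTwo_of_char_193 K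
  · exact not_holdsInDegree_sixtyThree_of_char_193 K
  · exact not_holdsInDegree_sixtyFour_of_char_193 K
  · exact not_holdsInDegree_of_choose_modEq_one K 193 (d := 65) (m := 10) (by norm_num) (by norm_num) (by decide)
  · exact not_holdsInDegree_sixtySix_of_char_193 K
  · exact not_holdsInDegree_of_choose_modEq_one K 193 (d := 67) (m := 22) (by norm_num) (by norm_num) (by decide)
  · exact not_holdsInDegree_sixtyEight_of_char_193 K
  · exact not_holdsInDegree_sixtyNine_of_char_193 K
  · exact not_holdsInDegree_seventy_of_char_193 K
  · exact not_holdsInDegree_seventyOne_of_char_193 K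
  · exact not_holdsInDegree_of_choose_modEq_one K 193 (d := 72) (m := 17) (by norm_num) (by norm_num) (by decide)
  · exact not_holdsInDegree_seventyThree_of_char_193 K
  · exact not_holdsInDegree_seventyFour_of_char_193 K
  · exact not_holdsInDegree_seventyFive_of_char_193 K
  · exact not_holdsInDegree_seventySix_of_char_193 K
  · exact not_holdsInDegree_of_choose_modEq_one K 193 (d := 77) (m := 11) (by norm_num) (by norm_num) (by decide)
  · exact not_holdsInDegree_seventyEight_of_char_193 K
  · exact not_holdsInDegree_of_choose_modEq_one K 193 (d := 79) (m := 18) (by norm_num) (by norm_num) (by decide)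
  · exact not_holdsInDegree_of_choose_modEq_one K 193 (d := 80) (m := 8) (by norm_num) (by norm_num) (by decide)
  · exact not_holdsInDegree_of_choose_modEq_one K 193 (d := 81) (m := 12) (by norm_num) (by norm_num) (by decide)
  · exact not_holdsInDegree_eightyTwo_of_char_193 K
  · exact not_holdsInDegree_eightyThree_of_char_193 K
  · exact not_holdsInDegree_of_choose_modEq_one K 193 (d := 84) (m := 35) (by norm_num) (by norm_num) (by decide)
  · exact not_holdsInDegree_of_choose_modEq_one K 193 (d := 85) (m := 14) (by norm_num) (by norm_num) (by decide)
  · exact not_holdsInDegree_eightySix_of_char_193 K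
  · exact not_holdsInDegree_eightySeven_of_char_193 K
  · exact not_holdsInDegree_eightyEight_of_char_193 K
  · exact not_holdsInDegree_eightyNine_of_char_193 K
  · exact not_holdsInDegree_ninety_of_char_193 K
  · exact not_holdsInDegree_of_choose_modEq_one K 193 (d := 91) (m := 7) (by norm_num) (by norm_num) (by decide)
  · exact not_holdsInDegree_ninetyTwo_of_char_193 K
  · exact not_holdsInDegree_ninetyThree_of_char_193 K
  · exact not_holdsInDegree_ninetyFour_of_char_193 K
  · exact not_holdsInDegree_ninetyFive_of_char_193 K
  · exact not_holdsInDegree_of_choose_modEq_one K 193 (d := 96) (m := 36) (by norm_num) (by norm_num) (by decide)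
  · exact not_holdsInDegree_ninetySeven_of_char_193 K
  · exact not_holdsInDegree_of_choose_modEq_one K 193 (d := 98) (m := 43) (by norm_num) (by norm_num) (by decide)
  · exact not_holdsInDegree_of_choose_modEq_one K 193 (d := 99) (m := 10) (by norm_num) (by norm_num) (by decide)
  · exact not_holdsInDegree_oneHundred_of_char_193 K
  · exact not_holdsInDegree_of_choose_modEq_one K 193 (d := 101) (m := 5) (by norm_num) (by norm_num) (by decide)
  · exact not_holdsInDegree_oneHundredTwo_of_char_193 K
  · exact not_holdsInDegree_of_choose_modEq_one K 193 (d := 103) (m := 10) (by norm_num) (by norm_num) (by decide)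
  · exact not_holdsInDegree_oneHundredFour_of_char_193 K
  · exact not_holdsInDegree_oneHundredFive_of_char_193 K
  · exact not_holdsInDegree_oneHundredSix_of_char_193 K
  · exact not_holdsInDegree_oneHundredSeven_of_char_193 K
  · exact not_holdsInDegree_oneHundredEight_of_char_193 K
  · exact not_holdsInDegree_of_choose_modEq_one K 193 (d := 109) (m := 54) (by norm_num) (by norm_num) (by decide)
  · exact not_holdsInDegree_oneHundredTen_of_char_193 K
  · exact not_holdsInDegree_oneHundredEleven_of_char_193 K
  · exact not_holdsInDegree_of_choose_modEq_one K 193 (d := 112) (m := 44) (by norm_num) (by norm_num) (by decide)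
  · exact not_holdsInDegree_oneHundredThirteen_of_char_193 K
  · exact not_holdsInDegree_oneHundredFourteen_of_char_193 K
  · exact not_holdsInDegree_oneHundredFifteen_of_char_193 K
  · exact not_holdsInDegree_oneHundredSixteen_of_char_193 K
  · exact not_holdsInDegree_oneHundredSeventeen_of_char_193 K
  · exact not_holdsInDegree_oneHundredEighteen_of_char_193 K
  · exact not_holdsInDegree_of_choose_modEq_one K 193 (d := 119) (m := 28) (by norm_num) (by norm_num) (by decide)
  · exact not_holdsInDegree_of_choose_modEq_one K 193 (d := 120) (m := 8) (by norm_num) (by norm_num) (by decide)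
  · exact not_holdsInDegree_of_choose_modEq_one K 193 (d := 121) (m := 14) (by norm_num) (by norm_num) (by decide)
  · exact not_holdsInDegree_oneHundredTwentyTwo_of_char_193 K
  · exact not_holdsInDegree_of_choose_modEq_one K 193 (d := 123) (m := 12) (by norm_num) (by norm_num) (by decide)
  · exact not_holdsInDegree_of_choose_modEq_one K 193 (d := 124) (m := 44) (by norm_num) (by norm_num) (by decide)
  · exact not_holdsInDegree_of_choose_modEq_one K 193 (d := 125) (m := 55) (by norm_num) (by norm_num) (by decide)
  · exact not_holdsInDegree_oneHundredTwentySix_of_char_193 K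
  · exact not_holdsInDegree_oneHundredTwentySeven_of_char_193 K
  · exact not_holdsInDegree_oneHundredTwentyEight_of_char_193 K
  · exact not_holdsInDegree_oneHundredTwentyNine_of_char_193 K
  · exact not_holdsInDegree_oneHundredThirty_of_char_193 K
  · exact not_holdsInDegree_of_choose_modEq_one K 193 (d := 131) (m := 18) (by norm_num) (by norm_num) (by decide)
  · exact not_holdsInDegree_of_choose_modEq_one K 193 (d := 132) (m := 11) (by norm_num) (by norm_num) (by decide)
  · exact not_holdsInDegree_oneHundredThirtyThree_of_char_193 K
  · exact not_holdsInDegree_oneHundredThirtyFour_of_char_193 K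
  · exact not_holdsInDegree_oneHundredThirtyFive_of_char_193 K
  · exact not_holdsInDegree_oneHundredThirtySix_of_char_193 K
  · exact not_holdsInDegree_of_choose_modEq_one K 193 (d := 137) (m := 10) (by norm_num) (by norm_num) (by decide)
  · exact not_holdsInDegree_of_choose_modEq_one K 193 (d := 138) (m := 42) (by norm_num) (by norm_num) (by decide)
  · exact not_holdsInDegree_oneHundredThirtyNine_of_char_193 K
  · exact not_holdsInDegree_oneHundredForty_of_char_193 K
  · exact not_holdsInDegree_oneHundredFortyOne_of_char_193 K
  · exact not_holdsInDegree_oneHundredFortyTwo_of_char_193 K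
  · exact not_holdsInDegree_oneHundredFortyThree_of_char_193 K
  · exact not_holdsInDegree_oneHundredFortyFour_of_char_193 K
  · exact not_holdsInDegree_oneHundredFortyFive_of_char_193 K
  · exact not_holdsInDegree_oneHundredFortySix_of_char_193 K
  · exact not_holdsInDegree_of_choose_modEq_one K 193 (d := 147) (m := 22) (by norm_num) (by norm_num) (by decide)
  · exact not_holdsInDegree_of_choose_modEq_one K 193 (d := 148) (m := 15) (by norm_num) (by norm_num) (by decide)
  · exact not_holdsInDegree_of_choose_modEq_one K 193 (d := 149) (m := 6) (by norm_num) (by norm_num) (by decide)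
  · exact not_holdsInDegree_of_choose_modEq_one K 193 (d := 150) (m := 54) (by norm_num) (by norm_num) (by decide)
  · exact not_holdsInDegree_oneHundredFiftyOne_of_char_193 K
  · exact not_holdsInDegree_oneHundredFiftyTwo_of_char_193 K
  · exact not_holdsInDegree_oneHundredFiftyThree_of_char_193 K
  · exact not_holdsInDegree_of_choose_modEq_one K 193 (d := 154) (m := 33) (by norm_num) (by norm_num) (by decide)
  · exact not_holdsInDegree_oneHundredFiftyFive_of_char_193 K
  · exact not_holdsInDegree_of_choose_modEq_one K 193 (d := 156) (m := 60) (by norm_num) (by norm_num) (by decide)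
  · exact not_holdsInDegree_of_choose_modEq_one K 193 (d := 157) (m := 11) (by norm_num) (by norm_num) (by decide)
  · exact not_holdsInDegree_oneHundredFiftyEight_of_char_193 K
  · exact not_holdsInDegree_of_choose_modEq_one K 193 (d := 159) (m := 3) (by norm_num) (by norm_num) (by decide)
  · exact not_holdsInDegree_oneHundredSixty_of_char_193 K
  · exact not_holdsInDegree_oneHundredSixtyOne_of_char_193 K
  · exact not_holdsInDegree_oneHundredSixtyTwo_of_char_193 K
  · exact not_holdsInDegree_oneHundredSixtyThree_of_char_193 K
  · exact not_holdsInDegree_oneHundredSixtyFour_of_char_193 K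
  · exact not_holdsInDegree_oneHundredSixtyFive_of_char_193 K
  · exact not_holdsInDegree_oneHundredSixtySix_of_char_193 K
  · exact not_holdsInDegree_oneHundredSixtySeven_of_char_193 K
  · exact not_holdsInDegree_oneHundredSixtyEight_of_char_193 K
  · exact not_holdsInDegree_oneHundredSixtyNine_of_char_193 K
  · exact not_holdsInDegree_oneHundredSeventy_of_char_193 K
  · exact not_holdsInDegree_of_choose_modEq_one K 193 (d := 171) (m := 18) (by norm_num) (by norm_num) (by decide)
  · exact not_holdsInDegree_oneHundredSeventyTwo_of_char_193 K
  · exact not_holdsInDegree_oneHundredSeventyThree_of_char_193 K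
  · exact not_holdsInDegree_oneHundredSeventyFour_of_char_193 K
  · exact not_holdsInDegree_oneHundredSeventyFive_of_char_193 K
  · exact not_holdsInDegree_oneHundredSeventySix_of_char_193 K
  · exact not_holdsInDegree_oneHundredSeventySeven_of_char_193 K
  · exact not_holdsInDegree_of_choose_modEq_one K 193 (d := 178) (m := 73) (by norm_num) (by norm_num) (by decide)
  · exact not_holdsInDegree_oneHundredSeventyNine_of_char_193 K
  · exact not_holdsInDegree_oneHundredEighty_of_char_193 K
  · exact not_holdsInDegree_of_choose_modEq_one K 193 (d := 181) (m := 35) (by norm_num) (by norm_num) (by decide)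
  · exact not_holdsInDegree_of_choose_modEq_one K 193 (d := 182) (m := 47) (by norm_num) (by norm_num) (by decide)
  · exact not_holdsInDegree_oneHundredEightyThree_of_char_193 K
  · exact not_holdsInDegree_of_choose_modEq_one K 193 (d := 184) (m := 72) (by norm_num) (by norm_num) (by decide)
  · exact not_holdsInDegree_of_choose_modEq_one K 193 (d := 185) (m := 84) (by norm_num) (by norm_num) (by decide)
  · exact not_holdsInDegree_oneHundredEightySix_of_char_193 K
  · exact not_holdsInDegree_of_choose_modEq_one K 193 (d := 187) (m := 91) (by norm_num) (by norm_num) (by decide)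
  · exact not_holdsInDegree_of_choose_modEq_one K 193 (d := 188) (m := 41) (by norm_num) (by norm_num) (by decide)
  · exact not_holdsInDegree_of_choose_modEq_one K 193 (d := 189) (m := 33) (by norm_num) (by norm_num) (by decide)
  · exact not_holdsInDegree_oneHundredNinety_of_char_193 K
  · exact not_holdsInDegree_oneHundredNinetyOne_of_char_193 K
  · exact not_holdsInDegree_of_choose_modEq_one K 193 (d := 192) (m := 2) (by norm_num) (by norm_num) (by decide)

/-- the positive digits `1 ≤ a ≤ 4`: `CA_{a·193^k}` over every field of characteristic `193`. [cite: GrafVonBothmerEtAl2007, Props. 2, 6] -/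
theorem holdsInDegree_mul_oneHundredNinetyThree_pow_of_le_four {a : ℕ} (ha0 : 0 < a) (ha4 : a ≤ 4) (k : ℕ) :
    HoldsInDegree K (a * 193 ^ k) := by
  haveI : Fact (Nat.Prime 193) := ⟨by norm_num⟩
  interval_cases a
  · simpa using holdsInDegree_prime_pow_field K 193 k
  · exact holdsInDegree_two_mul_prime_pow_field K 193 k
  · exact holdsInDegree_three_mul_prime_pow_field K 193 (by norm_num) k
  · exact holdsInDegree_mul_prime_pow_field K 193
      (holdsInDegree_of_le_four_of_charP (AlgebraicClosure K) 193 (by norm_num) le_rfl) k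

/-- **characteristic 193, complete**: over every field of characteristic `193`,
`CA_d ⟺ d = 0 ∨ d = a·193^k` with `a ∈ {1, 2, 3, 4, 6}` — NOT an initial segment of digits (`5` is bad, `6` is good), exactly as for `131`.
[cite: GrafVonBothmerEtAl2007, Props. 2, 6, 7] [cite: CastryckLaterveerOunaies2012, Thm. 4] -/
theorem classification_char_oneHundredNinetyThree_complete (d : ℕ) :
    HoldsInDegree K d ↔ d = 0 ∨ ∃ k a : ℕ, a ∈ ({1, 2, 3, 4, 6} : Finset ℕ) ∧ d = a * 193 ^ k := by
  haveI : Fact (Nat.Prime 193) := ⟨by norm_num⟩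
  constructor
  · intro h
    rcases Nat.eq_zero_or_pos d with rfl | hd
    · exact Or.inl rfl
    obtain ⟨k, a, ha0, hap, rfl, ha⟩ := digit_of_holdsInDegree K 193 hd.ne' h
    refine Or.inr ⟨k, a, ?_, rfl⟩
    by_cases ha4 : a ≤ 4
    · interval_cases a <;> simp
    · by_cases ha5 : a = 5
      · subst ha5
        exact absurd ha (not_holdsInDegree_five_of_charP_large K 193 (Or.inr (Or.inl rfl)))
      · by_cases ha6 : a = 6
        · subst ha6
          simp
        · exfalso
          exact not_holdsInDegree_digit_of_char_oneHundredNinetyThree K (by omega) hap ha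
  · rintro (rfl | ⟨k, a, ha, rfl⟩)
    · exact holdsInDegree_zero K
    · simp only [Finset.mem_insert, Finset.mem_singleton] at ha
      rcases ha with rfl | rfl | rfl | rfl | rfl
      · exact holdsInDegree_mul_oneHundredNinetyThree_pow_of_le_four K (by norm_num) (by norm_num) k
      · exact holdsInDegree_mul_oneHundredNinetyThree_pow_of_le_four K (by norm_num) (by norm_num) k
      · exact holdsInDegree_mul_oneHundredNinetyThree_pow_of_le_four K (by norm_num) (by norm_num) k
      · exact holdsInDegree_mul_oneHundredNinetyThree_pow_of_le_four K (by norm_num) (by norm_num) k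
      · exact holdsInDegree_six_mul_pow_of_char_193' K k

/-- the same classification in interval form (`1 ≤ a ≤ 6`, `a ≠ 5`), convenient for one-statement summaries over several characteristics.
[cite: GrafVonBothmerEtAl2007, Props. 2, 6, 7] [cite: CastryckLaterveerOunaies2012, Thm. 4] -/
theorem classification_char_oneHundredNinetyThree_complete' (d : ℕ) :
    HoldsInDegree K d ↔ d = 0 ∨ ∃ k a : ℕ, 0 < a ∧ a ≤ 6 ∧ a ≠ 5 ∧ d = a * 193 ^ k := by
  rw [classification_char_oneHundredNinetyThree_complete]
  have key : ∀ a : ℕ, a ∈ ({1, 2, 3, 4, 6} : Finset ℕ) ↔ 0 < a ∧ a ≤ 6 ∧ a ≠ 5 := by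
    intro a
    simp only [Finset.mem_insert, Finset.mem_singleton]
    omega
  simp only [key, and_assoc]

/-- the set of Casas-Alvero degrees `≤ 37249` in characteristic `193`, explicitly (corollary of the classification:
[cite: GrafVonBothmerEtAl2007, Prop. 6] with [cite: CastryckLaterveerOunaies2012, Thm. 4] and the digit refutations above). -/
theorem holdsInDegree_iff_mem_of_le_char_oneHundredNinetyThree_sq {d : ℕ} (hd : d ≤ 37249) :
    HoldsInDegree K d ↔ d ∈ ({0, 1, 2, 3, 4, 6, 193, 386, 579, 772, 1158, 37249} : Finset ℕ) := by
  rw [classification_char_oneHundredNinetyThree_complete]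
  constructor
  · rintro (rfl | ⟨k, a, ha, rfl⟩)
    · decide
    · simp only [Finset.mem_insert, Finset.mem_singleton] at ha
      rcases k with _ | _ | _ | k
      · rcases ha with rfl | rfl | rfl | rfl | rfl <;> decide
      · rcases ha with rfl | rfl | rfl | rfl | rfl <;> decide
      · rcases ha with rfl | rfl | rfl | rfl | rfl <;> simp_all
      · exfalso
        have ha0 : 0 < a := by rcases ha with rfl | rfl | rfl | rfl | rfl <;> norm_num
        have : 193 ^ 3 ≤ a * 193 ^ (k + 1 + 1 + 1) :=
          le_trans (Nat.pow_le_pow_right (by norm_num) (by omega)) (Nat.le_mul_of_pos_left _ ha0)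
        omega
  · intro h
    simp only [Finset.mem_insert, Finset.mem_singleton] at h
    rcases h with rfl | rfl | rfl | rfl | rfl | rfl | rfl | rfl | rfl | rfl | rfl | rfl
    · exact Or.inl rfl
    · exact Or.inr ⟨0, 1, by simp, by norm_num⟩
    · exact Or.inr ⟨0, 2, by simp, by norm_num⟩
    · exact Or.inr ⟨0, 3, by simp, by norm_num⟩
    · exact Or.inr ⟨0, 4, by simp, by norm_num⟩
    · exact Or.inr ⟨0, 6, by simp, by norm_num⟩
    · exact Or.inr ⟨1, 1, by simp, by norm_num⟩
    · exact Or.inr ⟨1, 2, by simp, by norm_num⟩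
    · exact Or.inr ⟨1, 3, by simp, by norm_num⟩
    · exact Or.inr ⟨1, 4, by simp, by norm_num⟩
    · exact Or.inr ⟨1, 6, by simp, by norm_num⟩
    · exact Or.inr ⟨2, 1, by simp, by norm_num⟩

end CharOneHundredNinetyThree

end Literature.Algebra.Polynomial.CasasAlvero
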